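import Summits.ResolutionOfSingularities.ResolutionOfSingularities.Theorems.WeightedInvariantOrderNonIncreasePartial
import HarnessLib

/-!
# «ν does not rise» over the special point of a CYLINDER centre `V(x, g)` with the P2 weights `(1, b)`, `b ≥ 2`
# (ORDER (o33-a), the P3a / CURVE° / TIE instance)

Topic: `Summits/ResolutionOfSingularities/ResolutionOfSingularities/Theorems`. Helper for the door item
`HypersurfaceCentreConstruction` (statement `stmt-ResolutionOfSingularities-19897`, route `WeightedInvariant`), line
`local-engine` of res-L1-w43-plan-1 (L W4.3), ORDER (o33-a) of `IOTA3-DESIGN.md` §5, after-care: the instance of the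
ν-half of (drop) that the CURVE° / TIE regimes of IOTA3-DESIGN v1.3 §8 consume (res-type-092 type (b), res-type-005
type (a)).  The centre is the cylinder `V(x, g)` of the (o28) rule with the closed P2 pair's weights `(1, b)`, read at a
SPECIAL point of the curve (a regular local ring `S` of any Krull dimension in which `x, g` are cotangent-independent);
the admissible level is `ℓ = b ν` with `ν = ord_𝔪 f`.

* `nu_succ_le_of_pair` — arithmetic: for `b ≥ 2`, every exponent `(i, j) ≠ (0, ν)` with `i + b j ≥ b ν` has `i + j ≥ ν + 1`
  (every monomial of `𝒥_{bν}(x, g; 1, b)` other than `g^ν` has ordinary degree `> ν`).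
* **`exists_finset_repr_isUnit_of_mem_weightedMonomialIdeal_pair`** — hence, in a LOCAL ring: if `f ∈ 𝒥_{bν}(x, g; 1, b)`
  and `f ∉ 𝔪^{ν+1}` then `f = Σ_{β∈Δ} a_β x^{β₀} g^{β₁}` over a finite set of exponents of weight `≥ bν` containing `(0, ν)`,
  with `a_{(0,ν)}` a UNIT (the Δ-form consumed by `OrderNonIncreasePartial.adicOrder_transform_le_of_isUnit_coeff`, p531510;
  the span form `f − c·g^ν ∈ (…)` is `OrderNonIncrease.exists_finset_repr_of_sub_mem_span`, p532882).
* **`adicOrder_le_of_cylinder_pair`** / `iotaOrd_le_of_cylinder_pair` — for `S` regular local, `(x, g)` cotangent-independent,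
  `b ≥ 2`, `f ∈ 𝒥_{bν}`, `f ∉ 𝔪^{ν+1}`: at EVERY prime `𝔫 ∋ t⁻¹` of `B = S[t⁻¹, 𝒥ₙtⁿ]` and for every factorisation
  `f = (t⁻¹)^a g′`, `t⁻¹ ∤ g′`: `ord_{B_𝔫} g′ ≤ ν` (by `OrderNonIncreasePartial.adicOrder_transform_le_of_isUnit_coeff`,
  p531510, with `α = (0, ν)`).

[OURS · L1 W4.3] Replaces the role of NO printed item; NOT a statement of the manuscript
[claim: Hironaka2017, status: under-review]. AI work, weaker than expert review. The case `b = 1` (homogeneous centre,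
`ℓ = ν`) is not covered by the unit-coefficient lemma (every weight-`ν` monomial has degree `ν`); there the consumer names
the unit monomial of the ν-form directly in `OrderNonIncrease…` (Δ-form).

## References

* J. Włodarczyk, *Functorial resolution by torus actions*, arXiv:2203.03090, Lemma 4.1.7. [Wlodarczyk2022]
* res-L1-w43-plan-1, `IOTA3-DESIGN.md` v1 §5 ORDER (o33-a), v1.3 §8 (CURVE°/TIE regimes) (OURS, AI planning).
-/

noncomputable section

open IsLocalRing Literature.AlgebraicGeometry.Resolution
open Summit.ResolutionOfSingularities.ResolutionOfSingularities.Cruxes.HypersurfaceCentreConstruction.LocalEngine (iotaOrd)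

set_option linter.dupNamespace false -- mandated namespace of this single-conjunct summit

namespace Summit.ResolutionOfSingularities.ResolutionOfSingularities.Theorems.OrderNonIncreasePartial

variable {S : Type} [CommRing S]

/-! ## Arithmetic of the weights `(1, b)`, `b ≥ 2` -/

/-- For `b ≥ 2`: an exponent `(i, j) ≠ (0, ν)` of weight `i + b j ≥ b ν` has ordinary degree `i + j ≥ ν + 1`. [folklore] -/
theorem nu_succ_le_of_pair {b ν i j : ℕ} (hb : 2 ≤ b) (h : b * ν ≤ i + b * j) (hne : ¬ (i = 0 ∧ j = ν)) :
    ν + 1 ≤ i + j := by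
  rcases Nat.lt_or_ge j ν with hj | hj
  · -- `j < ν`: `i ≥ b (ν - j) ≥ 2 (ν - j)`
    have key : (b : ℤ) * ν ≤ i + b * j := by exact_mod_cast h
    have hb' : (2 : ℤ) ≤ b := by exact_mod_cast hb
    have hj' : (j : ℤ) + 1 ≤ ν := by exact_mod_cast hj
    have : (ν : ℤ) + 1 ≤ i + j := by nlinarith [mul_nonneg (sub_nonneg.mpr hb') (sub_nonneg.mpr hj')]
    exact_mod_cast this
  · rcases hj.eq_or_lt with rfl | hlt
    · have hi : i ≠ 0 := fun hi => hne ⟨hi, rfl⟩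
      omega
    · omega

/-- The weight of `x^i g^j` for the weights `(1, b)` is `i + b j`. [folklore] -/
theorem sum_weights_pair (b : ℕ) (β : Fin 2 → ℕ) : ∑ i, (![1, b] : Fin 2 → ℕ) i * β i = β 0 + b * β 1 := by
  rw [Fin.sum_univ_two]
  simp

/-- The monomial `x^{β₀} g^{β₁}`. [folklore] -/
theorem prod_pair (x g : S) (β : Fin 2 → ℕ) : ∏ i, (![x, g] : Fin 2 → S) i ^ β i = x ^ β 0 * g ^ β 1 := by
  rw [Fin.prod_univ_two]
  simp

/-- `x^{β₀} g^{β₁} ∈ 𝔪^{β₀ + β₁}` for `x, g ∈ 𝔪`. [folklore] -/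
theorem prod_pair_mem_pow [IsLocalRing S] {x g : S} (hx : x ∈ maximalIdeal S) (hg : g ∈ maximalIdeal S)
    (β : Fin 2 → ℕ) : ∏ i, (![x, g] : Fin 2 → S) i ^ β i ∈ maximalIdeal S ^ (β 0 + β 1) := by
  rw [prod_pair, pow_add]
  exact Ideal.mul_mem_mul (Ideal.pow_mem_pow hx _) (Ideal.pow_mem_pow hg _)

/-! ## The `g^ν`-coefficient is a unit -/

/-- **In a local ring, `f ∈ 𝒥_{bν}(x, g; 1, b)` with `b ≥ 2` and `f ∉ 𝔪^{ν+1}` has a UNIT coefficient at `g^ν`** (Δ-form):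
`f = Σ_{β ∈ Δ} a_β x^{β₀} g^{β₁}` with `Δ ∋ (0, ν)` a finite set of exponents of weight `≥ b ν` and `a_{(0,ν)}` a unit — every
other monomial of the level has ordinary degree `≥ ν + 1`, so a non-unit coefficient at `g^ν` would put `f` in `𝔪^{ν+1}`.
[folklore] -/
theorem exists_finset_repr_isUnit_of_mem_weightedMonomialIdeal_pair [IsLocalRing S] {x g : S} (hx : x ∈ maximalIdeal S)
    (hg : g ∈ maximalIdeal S) {b : ℕ} (hb : 2 ≤ b) (ν : ℕ) {f : S}
    (hfJ : f ∈ weightedMonomialIdeal ![x, g] ![1, b] (b * ν)) (hford : f ∉ maximalIdeal S ^ (ν + 1)) :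
    ∃ (Δ : Finset (Fin 2 → ℕ)) (a : (Fin 2 → ℕ) → S), (![0, ν] : Fin 2 → ℕ) ∈ Δ ∧ IsUnit (a ![0, ν]) ∧
      (∀ β ∈ Δ, b * ν ≤ ∑ i, (![1, b] : Fin 2 → ℕ) i * β i) ∧
      f = ∑ β ∈ Δ, a β * ∏ i, (![x, g] : Fin 2 → S) i ^ β i := by
  classical
  rw [weightedMonomialIdeal] at hfJ
  obtain ⟨n, coef, gen, hsum⟩ := Submodule.mem_span_set'.mp hfJ
  have hgen : ∀ i, ∃ β : Fin 2 → ℕ, b * ν ≤ ∑ j, (![1, b] : Fin 2 → ℕ) j * β j ∧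
      ((gen i : S) = ∏ j, (![x, g] : Fin 2 → S) j ^ β j) := fun i => (gen i).2
  choose βf hβℓ hβeq using hgen
  set α : Fin 2 → ℕ := ![0, ν] with hαdef
  set Δ : Finset (Fin 2 → ℕ) := insert α (Finset.univ.image βf) with hΔ
  set a : (Fin 2 → ℕ) → S := fun γ => ∑ i ∈ Finset.univ.filter (fun i => βf i = γ), coef i with ha
  have hwα : ∑ i, (![1, b] : Fin 2 → ℕ) i * α i = b * ν := by rw [sum_weights_pair]; simp [α]
  -- `f = Σ_{γ ∈ Δ} a γ u^γ` (regroup the combination by exponent)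
  have hrepr : f = ∑ γ ∈ Δ, a γ * ∏ j, (![x, g] : Fin 2 → S) j ^ γ j := by
    have hfib := Finset.sum_fiberwise_of_maps_to (s := Finset.univ) (t := Δ) (g := βf)
      (fun i _ => Finset.mem_insert_of_mem (Finset.mem_image_of_mem βf (Finset.mem_univ i)))
      (fun i => coef i * ∏ j, (![x, g] : Fin 2 → S) j ^ βf i j)
    rw [← hsum]
    have hs : ∑ i, coef i • (gen i : S) = ∑ i, coef i * ∏ j, (![x, g] : Fin 2 → S) j ^ βf i j :=
      Finset.sum_congr rfl fun i _ => by rw [smul_eq_mul, hβeq i]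
    rw [hs, ← hfib]
    refine Finset.sum_congr rfl fun γ _ => ?_
    rw [Finset.sum_mul]
    refine Finset.sum_congr rfl fun i hi => ?_
    rw [(Finset.mem_filter.mp hi).2]
  have hΔw : ∀ β ∈ Δ, b * ν ≤ ∑ i, (![1, b] : Fin 2 → ℕ) i * β i := by
    intro β hβ
    rcases Finset.mem_insert.mp hβ with rfl | hβ'
    · rw [hwα]
    · obtain ⟨i, -, rfl⟩ := Finset.mem_image.mp hβ'
      exact hβℓ i
  refine ⟨Δ, a, Finset.mem_insert_self _ _, ?_, hΔw, hrepr⟩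
  -- a non-unit coefficient at `g^ν` would put `f` in `𝔪^{ν+1}`
  by_contra hcu
  have hc𝔪 : a α ∈ maximalIdeal S := (IsLocalRing.mem_maximalIdeal _).mpr (mem_nonunits_iff.mpr hcu)
  apply hford
  rw [hrepr]
  refine Ideal.sum_mem _ fun γ hγ => ?_
  by_cases hγα : γ = α
  · subst hγα
    rw [prod_pair, pow_succ']
    simp only [α, Matrix.cons_val_zero, Matrix.cons_val_one, pow_zero, one_mul]
    exact Ideal.mul_mem_mul hc𝔪 (Ideal.pow_mem_pow hg ν)
  · have hne : ¬ (γ 0 = 0 ∧ γ 1 = ν) := by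
      rintro ⟨h0, h1⟩
      apply hγα
      ext j
      fin_cases j
      · simpa [α] using h0
      · simpa [α] using h1
    have hw : b * ν ≤ γ 0 + b * γ 1 := by rw [← sum_weights_pair]; exact hΔw γ hγ
    exact Ideal.mul_mem_left _ _ (Ideal.pow_le_pow_right (nu_succ_le_of_pair hb hw hne) (prod_pair_mem_pow hx hg _))

/-! ## The order of the transform over the special point of the cylinder centre -/

section Successor

variable [IsRegularLocalRing S] {x g : S} (hmem : ∀ i, (![x, g] : Fin 2 → S) i ∈ maximalIdeal S)
  (hli : LinearIndependent (ResidueField S) fun i => (maximalIdeal S).toCotangent ⟨(![x, g] : Fin 2 → S) i, hmem i⟩)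

include hli

/-- **«ν does not rise» over the special point of the cylinder centre `V(x, g)` with weights `(1, b)`, `b ≥ 2`** (`adicOrder`
form): `S` regular local (any Krull dimension), `x, g` cotangent-independent, `f ∈ 𝒥_{bν}(x, g; 1, b)`, `f ∉ 𝔪^{ν+1}`; then at
every prime `𝔫 ∋ t⁻¹` of the cobordant algebra and for every factorisation `f = (t⁻¹)^a g′`, `t⁻¹ ∤ g′`: `ord_{B_𝔫} g′ ≤ ν`.
[OURS · L1 W4.3 · ORDER (o33-a), P3a/CURVE°/TIE instance] [cite: Wlodarczyk2022, Lemma 4.1.7] -/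
theorem adicOrder_le_of_cylinder_pair {b : ℕ} (hb : 2 ≤ b) (ν : ℕ) {f : S}
    (hfJ : f ∈ weightedMonomialIdeal ![x, g] ![1, b] (b * ν)) (hford : f ∉ maximalIdeal S ^ (ν + 1))
    (𝔫 : Ideal (extReesAlgebra (weightedMonomialIdeal (![x, g] : Fin 2 → S) ![1, b]))) [𝔫.IsPrime]
    (hT : extReesAlgebra.tInv (weightedMonomialIdeal (![x, g] : Fin 2 → S) ![1, b]) ∈ 𝔫)
    {a' : ℕ} {g' : extReesAlgebra (weightedMonomialIdeal (![x, g] : Fin 2 → S) ![1, b])}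
    (hfg : algebraMap S (extReesAlgebra (weightedMonomialIdeal (![x, g] : Fin 2 → S) ![1, b])) f =
      extReesAlgebra.tInv (weightedMonomialIdeal (![x, g] : Fin 2 → S) ![1, b]) ^ a' * g')
    (hndvd : ¬ extReesAlgebra.tInv (weightedMonomialIdeal (![x, g] : Fin 2 → S) ![1, b]) ∣ g') :
    adicOrder (algebraMap _ (Localization.AtPrime 𝔫) g') ≤ (ν : ℕ∞) := by
  obtain ⟨Δ, a, hαΔ, hunit, hm, hfΔ⟩ :=
    exists_finset_repr_isUnit_of_mem_weightedMonomialIdeal_pair (x := x) (g := g)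
      (show x ∈ maximalIdeal S from hmem 0) (show g ∈ maximalIdeal S from hmem 1) hb ν hfJ hford
  have hw : ∀ i, 0 < (![1, b] : Fin 2 → ℕ) i := fun i => by
    fin_cases i
    · simp
    · simp only [Fin.mk_one, Matrix.cons_val_one, Matrix.cons_val_fin_one]
      omega
  have hwα : ∑ i, (![1, b] : Fin 2 → ℕ) i * (![0, ν] : Fin 2 → ℕ) i = b * ν := by rw [sum_weights_pair]; simp
  have hr : (0 : S) ∈ weightedMonomialIdeal (![x, g] : Fin 2 → S) ![1, b] (b * ν + 1) := Ideal.zero_mem _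
  have h := adicOrder_transform_le_of_isUnit_coeff (![x, g] : Fin 2 → S) ![1, b] hmem hli hw Δ a (b * ν)
    (Nat.succ_pos _) hr hm (Nat.lt_succ_self _) (by rw [hfΔ, add_zero]) hαΔ hwα hunit 𝔫 hT hfg hndvd
  simpa using h

/-- **«ν does not rise» over the special point of the cylinder centre**, `iotaOrd` form.
[OURS · L1 W4.3 · ORDER (o33-a), P3a/CURVE°/TIE instance] [cite: Wlodarczyk2022, Lemma 4.1.7] -/
theorem iotaOrd_le_of_cylinder_pair {b : ℕ} (hb : 2 ≤ b) (ν : ℕ) {f : S}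
    (hfJ : f ∈ weightedMonomialIdeal ![x, g] ![1, b] (b * ν)) (hford : f ∉ maximalIdeal S ^ (ν + 1))
    (𝔫 : Ideal (extReesAlgebra (weightedMonomialIdeal (![x, g] : Fin 2 → S) ![1, b]))) [𝔫.IsPrime]
    (hT : extReesAlgebra.tInv (weightedMonomialIdeal (![x, g] : Fin 2 → S) ![1, b]) ∈ 𝔫)
    {a' : ℕ} {g' : extReesAlgebra (weightedMonomialIdeal (![x, g] : Fin 2 → S) ![1, b])}
    (hfg : algebraMap S (extReesAlgebra (weightedMonomialIdeal (![x, g] : Fin 2 → S) ![1, b])) f =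
      extReesAlgebra.tInv (weightedMonomialIdeal (![x, g] : Fin 2 → S) ![1, b]) ^ a' * g')
    (hndvd : ¬ extReesAlgebra.tInv (weightedMonomialIdeal (![x, g] : Fin 2 → S) ![1, b]) ∣ g') :
    iotaOrd (Localization.AtPrime 𝔫) (algebraMap _ (Localization.AtPrime 𝔫) g') ≤ (ν : Ordinal) := by
  obtain ⟨Δ, a, hαΔ, hunit, hm, hfΔ⟩ :=
    exists_finset_repr_isUnit_of_mem_weightedMonomialIdeal_pair (x := x) (g := g)
      (show x ∈ maximalIdeal S from hmem 0) (show g ∈ maximalIdeal S from hmem 1) hb ν hfJ hford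
  have hw : ∀ i, 0 < (![1, b] : Fin 2 → ℕ) i := fun i => by
    fin_cases i
    · simp
    · simp only [Fin.mk_one, Matrix.cons_val_one, Matrix.cons_val_fin_one]
      omega
  have hwα : ∑ i, (![1, b] : Fin 2 → ℕ) i * (![0, ν] : Fin 2 → ℕ) i = b * ν := by rw [sum_weights_pair]; simp
  have hr : (0 : S) ∈ weightedMonomialIdeal (![x, g] : Fin 2 → S) ![1, b] (b * ν + 1) := Ideal.zero_mem _
  have h := iotaOrd_transform_le_of_isUnit_coeff (![x, g] : Fin 2 → S) ![1, b] hmem hli hw Δ a (b * ν)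
    (Nat.succ_pos _) hr hm (Nat.lt_succ_self _) (by rw [hfΔ, add_zero]) hαΔ hwα hunit 𝔫 hT hfg hndvd
  simpa using h

end Successor

end Summit.ResolutionOfSingularities.ResolutionOfSingularities.Theorems.OrderNonIncreasePartial
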